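import Summits.HodgeConjecture.HodgeConjecture.Theorems.SecondaryPeriodsConiveauOneFailureInstrumentForm

/-!
# Route `SecondaryPeriods`, crux `ConiveauOneFailure` (stmt-HodgeConjecture-3540): the heart of the
# line as an explicit counterexample to the Hodge conjecture on `Y × C`

Sequel of `Theorems/SecondaryPeriodsConiveauOneFailureInstrumentForm` (the heart of the registered
line ⟺ one non-algebraic rank-two level-one curve correspondence into a Calabi–Yau-type threefold).
Here the heart is read at the level of the summit statement itself:

* `exists_nonalgebraic_hodgeClass_tensor_curve_of_heart` — the heart yields a threefold `Y` with
  `h^{3,0}(Y) = 1`, a smooth projective curve `C` and a RATIONAL class of Hodge type `(2,2)` in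
  `H⁴((Y ⊗ C)(ℂ); ℂ)` which is NOT algebraic (the sibling lead's
  `span_le_supportedClasses_of_finrank_eq_two_of_hodgeConjectureFor`, contrapositively);
* `exists_not_hodgeConjectureFor_tensor_curve_of_heart` — hence `HodgeConjectureFor 4 (Y ⊗ C)` fails
  for that fourfold: the negative bet of the route is, verbatim, a counterexample to the Hodge
  conjecture on (Calabi–Yau threefold) × (curve);
* `forall_orientationFamily_not_exists_corrAction_eq_iff` — the obstruction clause of the instrument
  form ("for NO orientation family is `φ` the action of an algebraic class") is equivalent to its
  instance for the complex orientation family (orientation families rescale `[γ]_*` by a non-zero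
  scalar), so the `∀ μ` there is cosmetic.

## References

* [GrothendieckTopology1969] A. Grothendieck, Hodge's general conjecture is false for trivial
  reasons, Topology 8 (1969), p. 301.
* [KerrPearlstein2016] M. Kerr, G. Pearlstein (eds.), Recent Advances in Hodge Theory, Ch. 11
  (S. Abdulali), Prop. 3.2 p. 291.
* [VoisinHodgeI2002] C. Voisin, Hodge Theory and Complex Algebraic Geometry I, §11.3.3 Lemma 11.41.
* [FultonYoungTableaux1997] W. Fulton, Young Tableaux, Appendix B §B.1 (5).
-/

noncomputable section

-- every declaration of this problem lives in `Summit.HodgeConjecture.HodgeConjecture.…` (summit = sub-problem), which `linter.dupNamespace` flags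
set_option linter.dupNamespace false

namespace Summit.HodgeConjecture.HodgeConjecture.Theorems

open CategoryTheory MonoidalCategory
open Literature.AlgebraicGeometry.Motives Literature.AlgebraicGeometry.HodgeTheory
  Literature.AlgebraicTopology.SingularHomology

/-! ### The heart as an explicit counterexample to the Hodge conjecture on `Y × C` -/

/-- **The heart exhibits a non-algebraic rational `(2,2)`-class on a fourfold `Y × C`, `Y` of
Calabi–Yau type.** If the registered heart of the line holds, then for its threefold `Y`
(`h^{3,0}(Y) = 1`) and SOME smooth projective curve `C` there is a rational class of Hodge type
`(2,2)` in `H⁴((Y ⊗ C)(ℂ); ℂ)` which is not algebraic — by the sibling lead's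
`span_le_supportedClasses_of_finrank_eq_two_of_hodgeConjectureFor` (HC in codimension 2 on all
`Y ⊗ C` forces every rank-2 level-one plane of `H³(Y)` into `N¹H³(Y)`; rank-two Riemann + Voisin I
Lemma 11.41 + the Gysin support property), contrapositively. This is the summit-level content of the
negative bet: a counterexample to the Hodge conjecture on (CY threefold) × (curve).
[cite: GrothendieckTopology1969, p. 301] [cite: KerrPearlstein2016, Ch. 11 (Abdulali) Prop. 3.2 p. 291]
[cite: VoisinHodgeI2002, §11.3.3 Lemma 11.41] -/
theorem exists_nonalgebraic_hodgeClass_tensor_curve_of_heart :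
    (∃ (Y : SchemeOver ℂ) (_ : IsSmoothProjective 3 Y) (A : HodgeModel 3 Y)
      (s : Finset (complexBetti Y 3)),
      (∀ c ∈ s, IsRationalClass c) ∧
      (Submodule.span ℂ (↑s : Set (complexBetti Y 3))).map (A.pullback 3).hom =
        (⨆ (p : ℕ) (q : ℕ) (_ : p + q = 3),
          (Submodule.span ℂ (↑s : Set (complexBetti Y 3))).map (A.pullback 3).hom ⊓
            A.hodgePQ 3 p q) ∧
      (Submodule.span ℂ (↑s : Set (complexBetti Y 3))).map (A.pullback 3).hom ≤
        (⨆ (p : ℕ) (q : ℕ) (_ : p + q = 3) (_ : 1 ≤ p) (_ : 1 ≤ q), A.hodgePQ 3 p q) ∧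
      Module.finrank ℂ (A.hodgePQ 3 3 0) = 1 ∧
      Module.finrank ℂ (Submodule.span ℂ (↑s : Set (complexBetti Y 3))) = 2 ∧
      ¬ ∃ (ι : Type) (_ : Finite ι) (C : ι → SchemeOver ℂ) (_ : ∀ j, IsSmoothProjective 1 (C j))
          (T : ∀ j, complexBetti (C j) 1 →ₗ[ℂ] complexBetti Y 3),
          (∀ j, IsAlgebraicCorrespondence 3 1 Y (C j) (T j)) ∧
            Submodule.span ℂ (↑s : Set (complexBetti Y 3)) ≤ ⨆ j, LinearMap.range (T j)) →
    ∃ (Y C : SchemeOver ℂ) (_ : IsSmoothProjective 3 Y) (_ : IsSmoothProjective 1 C)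
      (A : HodgeModel 3 Y) (γ : complexBetti (Y ⊗ C) (2 * 2)),
      Module.finrank ℂ (A.hodgePQ 3 3 0) = 1 ∧ IsRationalClass γ ∧
        IsOfHodgeType (3 + 1) (Y ⊗ C) (2 * 2) 2 2 γ ∧ γ ∉ algebraicClasses (Y ⊗ C) 2 := by
  rintro ⟨Y, hY, A, s, hs, hsub, hlev, h30, hs2, hoff⟩
  by_contra hne
  refine hoff ((le_supportedClasses_iff_exists_curveCorrespondences hY _).1
    (span_le_supportedClasses_of_finrank_eq_two_of_hodgeConjectureFor hY (fun C hC γ hγ hγH ↦ ?_)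
      A s hs hs2 hsub hlev))
  by_contra hγalg
  exact hne ⟨Y, C, hY, hC, A, γ, h30, hγ, hγH, hγalg⟩

/-- **The heart refutes the Hodge conjecture for a specific fourfold `Y ⊗ C`** (`Y` the heart's
Calabi–Yau-type threefold, `C` some smooth projective curve): the tree's per-variety statement
`HodgeConjectureFor 4 (Y ⊗ C)` fails. [cite: GrothendieckTopology1969, p. 301] -/
theorem exists_not_hodgeConjectureFor_tensor_curve_of_heart :
    (∃ (Y : SchemeOver ℂ) (_ : IsSmoothProjective 3 Y) (A : HodgeModel 3 Y)
      (s : Finset (complexBetti Y 3)),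
      (∀ c ∈ s, IsRationalClass c) ∧
      (Submodule.span ℂ (↑s : Set (complexBetti Y 3))).map (A.pullback 3).hom =
        (⨆ (p : ℕ) (q : ℕ) (_ : p + q = 3),
          (Submodule.span ℂ (↑s : Set (complexBetti Y 3))).map (A.pullback 3).hom ⊓
            A.hodgePQ 3 p q) ∧
      (Submodule.span ℂ (↑s : Set (complexBetti Y 3))).map (A.pullback 3).hom ≤
        (⨆ (p : ℕ) (q : ℕ) (_ : p + q = 3) (_ : 1 ≤ p) (_ : 1 ≤ q), A.hodgePQ 3 p q) ∧
      Module.finrank ℂ (A.hodgePQ 3 3 0) = 1 ∧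
      Module.finrank ℂ (Submodule.span ℂ (↑s : Set (complexBetti Y 3))) = 2 ∧
      ¬ ∃ (ι : Type) (_ : Finite ι) (C : ι → SchemeOver ℂ) (_ : ∀ j, IsSmoothProjective 1 (C j))
          (T : ∀ j, complexBetti (C j) 1 →ₗ[ℂ] complexBetti Y 3),
          (∀ j, IsAlgebraicCorrespondence 3 1 Y (C j) (T j)) ∧
            Submodule.span ℂ (↑s : Set (complexBetti Y 3)) ≤ ⨆ j, LinearMap.range (T j)) →
    ∃ (Y C : SchemeOver ℂ) (_ : IsSmoothProjective 3 Y) (_ : IsSmoothProjective 1 C)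
      (A : HodgeModel 3 Y),
      Module.finrank ℂ (A.hodgePQ 3 3 0) = 1 ∧ ¬ HodgeConjectureFor (3 + 1) (Y ⊗ C) := by
  intro h
  obtain ⟨Y, C, hY, hC, A, γ, h30, hγ, hγH, hγalg⟩ :=
    exists_nonalgebraic_hodgeClass_tensor_curve_of_heart h
  exact ⟨Y, C, hY, hC, A, h30, fun hHC ↦ hγalg (hHC.2 2 γ hγ hγH)⟩

/-- **The obstruction does not depend on the orientation family**: a map `φ : H¹(C(ℂ)) → H³(Y(ℂ))`
is the action of no algebraic codimension-2 class on `Y ⊗ C` for EVERY orientation family iff it is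
so for the complex orientation family — two families with Poincaré duality rescale `[γ]_*` by a
non-zero scalar (`corrAction_eq_smul_of_orientationFamily`) and `algebraicClasses` is a subspace. So
the quantifier `∀ μ` in the instrument form of the heart is cosmetic. [cite: FultonYoungTableaux1997, Appendix B §B.1 (5)] -/
theorem forall_orientationFamily_not_exists_corrAction_eq_iff {Y C : SchemeOver ℂ}
    (hY : IsSmoothProjective 3 Y) (hC : IsSmoothProjective 1 C)
    (φ : complexBetti C 1 →ₗ[ℂ] complexBetti Y 3) :
    (∀ μ : OrientationFamily, ¬ ∃ γ ∈ algebraicClasses (Y ⊗ C) 2,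
        corrAction μ hY hC (show 1 + 2 * 2 = 3 + 2 * 1 from rfl) γ = φ) ↔
      ¬ ∃ γ ∈ algebraicClasses (Y ⊗ C) 2,
        corrAction complexOrientationFamily hY hC (show 1 + 2 * 2 = 3 + 2 * 1 from rfl) γ = φ := by
  refine ⟨fun h ↦ h complexOrientationFamily, fun h μ ⟨γ, hγ, hγφ⟩ ↦ h ?_⟩
  obtain ⟨c, -, hcμ⟩ := corrAction_eq_smul_of_orientationFamily
    (OrientationFamily.hasPoincareDuality complexOrientationFamily) (OrientationFamily.hasPoincareDuality μ)
    hY hC (show 1 + 2 * 2 = 3 + 2 * 1 from rfl)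
  refine ⟨c • γ, Submodule.smul_mem _ _ hγ, ?_⟩
  rw [map_smul, ← LinearMap.smul_apply, ← hcμ, hγφ]

end Summit.HodgeConjecture.HodgeConjecture.Theorems

end
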